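import Summits.NavierStokesRegularity.NavierStokesRegularity.Theorems.PerpetualPumpThesisFloor
import Summits.NavierStokesRegularity.NavierStokesRegularity.Theorems.PerpetualPumpThesisEnvelopeTightness

/-!
# Line `SketchIdeator2` for `PerpetualPump.Thesis`: the crux IS `EnvelopeUpgrade ∧ NoPersistentFront`

Support file (crux stmt-NavierStokesRegularity-1832, line `SketchIdeator2` = idea `besov-envelope-floor`;
lead's closing summary of cycle 1). With the abstract Leray floor in the Besov envelope a THEOREM for every
averaging datum (`stub_thesis_AbstractLerayFloor`, `Theorems/PerpetualPumpThesisFloor.lean`) and the two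
tightness lemmas (`stub_envelopeUpgrade_Tight`, `stub_noPersistentFront_Tight`,
`Theorems/PerpetualPumpThesisEnvelopeTightness.lean`), the route's target

  `Thesis` (abstract Type-I exclusion over Tao's averaging class, J. Amer. Math. Soc. 29 (2016) §1.1,
  the open question of his p. 8 footnote at the `L^∞`-rate tier)

is EQUIVALENT to the conjunction of the line's two remaining registered stubs, both statements about
the envelope amplitude `a(t) = √(T-t) ‖u(t)‖_{Ḃ⁰_{∞,1}}` of an `H¹⁰_df`-mild solution of a symmetric
averaged equation with cancellation:

* K2 `EnvelopeUpgrade` — a Type-I bound in `L^∞` forces `sup_t a(t) < ∞` ("no log-hot stack");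
* K1 `NoPersistentFront` — `a` cannot stay pinched in `[ε, M']` on all of `[0,T)` ("no pump").

`stub_thesis_iff_envelope` below records exactly this (`→`: tightness; `←`: the planner's composition
`thesis_of_floor_upgrade_noFront` with the floor discharged). All perturbative content of the crux is
thereby removed: what is left is the genuinely open dichotomy (K1 ⊇ forward Navier–Stokes Type-I
exclusion for envelope-bounded blow-ups, via the Euler datum; predicted FALSE by the route's ODE pump
`CircuitPump`, now a theorem of the tree, pending `PumpTransfer`).
-/

noncomputable section

open MeasureTheory Set Filter Topology
open scoped ENNReal NNReal SchwartzMap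

set_option linter.dupNamespace false

namespace Summit.NavierStokesRegularity.NavierStokesRegularity.Theorems.PerpetualPumpThesis

open Literature.Analysis.FluidPDE Literature.Analysis.FluidPDE.Tao2016
open Literature.Analysis.FunctionSpaces
open Summit.NavierStokesRegularity.NavierStokesRegularity.Theses.PerpetualPump

/-- **The crux `Thesis` is equivalent to `EnvelopeUpgrade ∧ NoPersistentFront`** (line
`SketchIdeator2`, idea `besov-envelope-floor`): forward by the tightness lemmas, backward by the
planner's dichotomy — given a Type-I `u`, K2 bounds its envelope amplitude by `M'`; either the
amplitude dips below the floor `ε(𝒜)` at some time, and the abstract Leray floor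
(`stub_thesis_AbstractLerayFloor`) extends `u`, or it stays pinched in `[ε, M']`, which K1 forbids. -/
theorem stub_thesis_iff_envelope : Summit.NavierStokesRegularity.NavierStokesRegularity.Theses.PerpetualPump.Thesis ↔ ((∀ 𝒜 : AveragingDatum, 𝒜.IsSymmetric → 𝒜.HasCancellation → ∀ u₀ : 𝓢(EuclideanSpace ℝ (Fin 3), EuclideanSpace ℝ (Fin 3)), VectorCalculus.IsDivFree ⇑u₀ → ∀ T : ℝ, 0 < T → ∀ u : ℝ → L2C, 𝒜.IsMildSolution (schwartzL2 u₀) (Ico 0 T) u → (∃ M : ℝ, ∀ t ∈ Ico 0 T, eLpNorm (u t) ⊤ volume ≤ ENNReal.ofReal (M / Real.sqrt (T - t))) → ∃ M' : ℝ, ∀ t ∈ Ico 0 T, ENNReal.ofReal (Real.sqrt (T - t)) * eHomBesovNorm 0 ⊤ 1 ((u t : L2C) : 𝓢'(EuclideanSpace ℝ (Fin 3), EuclideanSpace ℂ (Fin 3))) ≤ ENNReal.ofReal M') ∧ (∀ 𝒜 : AveragingDatum, 𝒜.IsSymmetric → 𝒜.HasCancellation → ∀ u₀ : 𝓢(EuclideanSpace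 ℝ (Fin 3), EuclideanSpace ℝ (Fin 3)), VectorCalculus.IsDivFree ⇑u₀ → ∀ T : ℝ, 0 < T → ∀ u : ℝ → L2C, 𝒜.IsMildSolution (schwartzL2 u₀) (Ico 0 T) u → ∀ ε M' : ℝ, 0 < ε → (∀ t ∈ Ico 0 T, ENNReal.ofReal ε ≤ ENNReal.ofReal (Real.sqrt (T - t)) * eHomBesovNorm 0 ⊤ 1 ((u t : L2C) : 𝓢'(EuclideanSpace ℝ (Fin 3), EuclideanSpace ℂ (Fin 3))) ∧ ENNReal.ofReal (Real.sqrt (T - t)) * eHomBesovNorm 0 ⊤ 1 ((u t : L2C) : 𝓢'(EuclideanSpace ℝ (Fin 3), EuclideanSpace ℂ (Fin 3))) ≤ ENNReal.ofReal M') → False)) := by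
  constructor
  · exact fun h => ⟨stub_envelopeUpgrade_Tight h, stub_noPersistentFront_Tight h⟩
  · rintro ⟨hU, hN⟩ 𝒜 hs hc u₀ hdiv T hT u hmild hrate
    obtain ⟨ε, hε, hfloor⟩ := stub_thesis_AbstractLerayFloor 𝒜
    obtain ⟨M', hM'⟩ := hU 𝒜 hs hc u₀ hdiv T hT u hmild hrate
    by_cases hdip : ∃ t₀ ∈ Ico 0 T, ENNReal.ofReal (Real.sqrt (T - t₀)) *
        eHomBesovNorm 0 ⊤ 1 ((u t₀ : L2C) : 𝓢'(EuclideanSpace ℝ (Fin 3), EuclideanSpace ℂ (Fin 3))) ≤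
          ENNReal.ofReal ε
    · exact hfloor u₀ hdiv T hT u hmild hdip
    · push Not at hdip
      exact (hN 𝒜 hs hc u₀ hdiv T hT u hmild ε M' hε fun t ht => ⟨(hdip t ht).le, hM' t ht⟩).elim

end Summit.NavierStokesRegularity.NavierStokesRegularity.Theorems.PerpetualPumpThesis

end
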